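import Mathlib
import Summits.NavierStokesRegularity.NavierStokesRegularity.Theorems.L3TimeExponentPincerCoupledClock
import Literature.Analysis.FluidPDE.TaoLocalisationHolds
import Literature.Analysis.FluidPDE.TaoLocalisationContinuation
import HarnessLib.Audit
import HarnessLib

/-!
# The Sobolev–Morrey majorant `Φ_S = √(A · e₀ · δ)` of every frame solution, and the node arrow
# `AllBlowupsDissipationFiveFourths ⇒ AllBlowupsCoupledClockB`
# (route `L3TimeExponentPincer`, crux `L3CascadeJaw`, stmt-NavierStokesRegularity-19499)

Support file for the parent crux `L3CascadeJaw` (cell ns-regularity-ideate, seat nsreg-p4 gen 6), on top of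
the landed `…Theorems.L3TimeExponentPincerCoupledClock` (nsreg-p2 ROUND-10, p444296).  That file typed the
coupled-clock node `AllBlowupsCoupledClockB` ("every frame blow-up has a Morrey-rate majorant `Φ` with
`Φ·δ ∈ L^s(T₁,T)` for all `s < 5/6`") and proved `AllBlowupsFullMorreyB ⇒ AllBlowupsCoupledClockB`; the arrow
from the DISSIPATION node `AllBlowupsDissipationFiveFourths` (`…DissipationAxis`, p442318) was recorded "at memo
level" only (module docstring there: "the elementary majorant `Φ ≲ √(e₀ δ)`").  This file makes it a kernel
theorem and records the majorant itself, which exists for EVERY frame solution (no blow-up hypothesis):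

* `lintegral_ball_sq_le_of_eLpNorm_six` — Hölder on a ball: `∫_{B(x₀,r)} |w|² ≤ |B_r|^{2/3} ‖w‖₆²`;
* `lintegral_ball_sq_le_sobolev` — with the whole-space Sobolev inequality `‖w‖₆ ≤ K ‖Dw‖₂`
  (`eLpNorm_six_le_eLpNorm_fderiv_two`): `∫_{B(x₀,r)} |w|² ≤ A · δ(w) · r²`, `A = V₁^{2/3} K²`,
  `δ(w) = ∫ |∇w|²_F` — the Sobolev end of the scaled-energy bookkeeping (sharp on a single concentrated eddy);
* `lintegral_ball_sq_le_sqrt_mul` — interpolating with the energy: `∫_{B(x₀,r)} |w|² ≤ min(e₀, A δ r²) ≤ √(e₀ A δ) · r`,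
  i.e. **`Φ_S := √(A e₀ δ)` is a Morrey-rate majorant at ALL radii**;
* `dissipRate_lt_top_of_frame` — `δ(t) < ∞` at every `t ∈ [0,T)` for the frame (Tao 2013 Cor. 11.1: bounded
  Sobolev norms on closed sub-slabs, `tao2011_hasBoundedSobolevNormsOn_holds`), so `Φ_S(t)` is a genuine `ℝ≥0`;
* `morreyRateNear_sobolevMajorant` — **every frame solution satisfies `MorreyRateNear u T (Φ_S u)`**, and
  `lintegral_sobolevMajorant_sq_lt_top` — `∫_{0}^{T} Φ_S² = A e₀ ∫₀ᵀ δ < ∞`: the majorant is in `L²_t`, which under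
  J″'s exponent map `a ↦ q = 6a/(1+a)` is exactly the energy floor `q = 4` (the kernel form of the ROUND-10 remark
  "every energy-class input lands on `a = 2`");
* `allBlowupsCoupledClockB_of_dissipationFiveFourths : AllBlowupsDissipationFiveFourths → AllBlowupsCoupledClockB` —
  with `Φ = Φ_S`, `(Φ_S δ)^s = (A e₀)^{s/2} δ^{3s/2}` and `3s/2 < 5/4 ⇔ s < 5/6`.  Hence the by-name web of typed
  sufficient hypotheses for the crux reads
  `NoTypeII ⇒ FullMorreyB ⇒ CoupledClockB ⇐ DissipationFiveFourths`, `CoupledClockB ⇒ L3CascadeJaw`: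
  the coupled clock is the weakest typed node of the route, below BOTH one-axis nodes.

References: J. C. Robinson, J. L. Rodrigo, W. Sadowski, *The three-dimensional Navier–Stokes equations*
(2016), Thm 1.8 / Lemma 3.5 (Sobolev and Lebesgue interpolation); T. Tao, *Localisation and compactness
properties of the Navier–Stokes global regularity problem*, Anal. PDE 6 (2013), Cor. 11.1.
WHAT THIS IS NOT: not a claim about Navier–Stokes regularity or blow-up; no item is closed; the nodes are
typed hypotheses (open), the arrows between them are kernel theorems.
-/

noncomputable section

namespace Summit.NavierStokesRegularity.NavierStokesRegularity.Theorems.L3TimeExponentPincerSobolevMajorant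

open MeasureTheory Set Function Filter Metric Topology
open scoped ENNReal NNReal
open Literature.Analysis.FluidPDE
open Summit.NavierStokesRegularity.NavierStokesRegularity.Theorems.L3TimeExponentPincerMorreyGrowth
  (V₁ volume_ball_eq V₁_nonneg)
open Summit.NavierStokesRegularity.NavierStokesRegularity.Theorems.L3TimeExponentPincerJawFullMorrey
  (dissipRate dissip_lt_top AllBlowupsFullMorreyB)
open Summit.NavierStokesRegularity.NavierStokesRegularity.Theorems.L3TimeExponentPincerJawMorreyRate
  (MorreyRateNear)
open Summit.NavierStokesRegularity.NavierStokesRegularity.Theorems.L3TimeExponentPincerDissipationAxis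
  (AllBlowupsDissipationFiveFourths)
open Summit.NavierStokesRegularity.NavierStokesRegularity.Theorems.L3TimeExponentPincerCoupledClock
  (AllBlowupsCoupledClockB allBlowupsCoupledClockB_of_fullMorreyB l3CascadeJaw_of_allBlowupsCoupledClockB)
open Summit.NavierStokesRegularity.NavierStokesRegularity.Theses.L3TimeExponentPincer (L3CascadeJaw)

/-! ## §1  Hölder on a ball and the Sobolev end of the scaled energy -/

/-- The whole-space Gagliardo–Nirenberg–Sobolev constant `K` of `‖w‖₆ ≤ K ‖Dw‖₂` on `ℝ³`. -/
def K₆ : ℝ≥0 :=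
  SNormLESNormFDerivOfEqConst (EuclideanSpace ℝ (Fin 3)) (volume : Measure (EuclideanSpace ℝ (Fin 3))) 2

/-- The Sobolev–Morrey constant `A = V₁^{2/3} K²` of `∫_{B_r} |w|² ≤ A δ(w) r²`. -/
def sobolevMorreyConst : ℝ≥0∞ :=
  ENNReal.ofReal V₁ ^ (2 / 3 : ℝ) * (K₆ : ℝ≥0∞) ^ 2

/-- `A < ∞`. -/
theorem sobolevMorreyConst_lt_top : sobolevMorreyConst < ⊤ :=
  ENNReal.mul_lt_top (ENNReal.rpow_lt_top_of_nonneg (by norm_num) ENNReal.ofReal_ne_top)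
    (ENNReal.pow_lt_top ENNReal.coe_lt_top)

/-- **Hölder on a ball**: `∫_{B(x₀,r)} |w|² ≤ |B(x₀,r)|^{2/3} · ‖w‖_{L⁶}²` (exponents `3` and `3/2`).
[cite: RobinsonRodrigoSadowski2016, Lemma 3.5] -/
theorem lintegral_ball_sq_le_of_eLpNorm_six {w : EuclideanSpace ℝ (Fin 3) → EuclideanSpace ℝ (Fin 3)}
    (hw : AEStronglyMeasurable w volume) (x₀ : EuclideanSpace ℝ (Fin 3)) (r : ℝ) :
    ∫⁻ x in ball x₀ r, ‖w x‖ₑ ^ 2 ≤ volume (ball x₀ r) ^ (2 / 3 : ℝ) * eLpNorm w 6 volume ^ 2 := by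
  set μ : Measure (EuclideanSpace ℝ (Fin 3)) := volume.restrict (ball x₀ r) with hμ
  have h1 : eLpNorm w 2 μ ≤ eLpNorm w 6 μ * μ univ ^ (1 / (2 : ℝ≥0∞).toReal - 1 / (6 : ℝ≥0∞).toReal) :=
    eLpNorm_le_eLpNorm_mul_rpow_measure_univ (by norm_num) hw.restrict
  have h13 : 1 / (2 : ℝ≥0∞).toReal - 1 / (6 : ℝ≥0∞).toReal = (1 / 3 : ℝ) := by norm_num
  rw [h13, hμ, Measure.restrict_apply_univ] at h1
  have h2 : eLpNorm w 6 μ ≤ eLpNorm w 6 volume := eLpNorm_mono_measure w Measure.restrict_le_self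
  calc ∫⁻ x in ball x₀ r, ‖w x‖ₑ ^ 2 = eLpNorm w 2 μ ^ 2 := lintegral_enorm_sq_eq_eLpNorm_two_pow μ w
    _ ≤ (eLpNorm w 6 volume * volume (ball x₀ r) ^ (1 / 3 : ℝ)) ^ 2 :=
        pow_le_pow_left' (h1.trans (mul_le_mul' h2 le_rfl)) 2
    _ = volume (ball x₀ r) ^ (2 / 3 : ℝ) * eLpNorm w 6 volume ^ 2 := by
        rw [mul_pow, ← ENNReal.rpow_natCast (volume (ball x₀ r) ^ (1 / 3 : ℝ)) 2, ← ENNReal.rpow_mul]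
        norm_num
        rw [mul_comm]

/-- `|B(x₀,r)|^{2/3} = V₁^{2/3} r²` in `ℝ³` (`0 < r`). -/
theorem volume_ball_rpow_twoThirds (x₀ : EuclideanSpace ℝ (Fin 3)) {r : ℝ} (hr : 0 < r) :
    volume (ball x₀ r) ^ (2 / 3 : ℝ) = ENNReal.ofReal V₁ ^ (2 / 3 : ℝ) * ENNReal.ofReal (r ^ 2) := by
  have h3 : (r ^ 3 : ℝ) ^ (2 / 3 : ℝ) = r ^ 2 := by
    rw [← Real.rpow_natCast r 3, ← Real.rpow_mul hr.le, show ((3 : ℕ) : ℝ) * (2 / 3) = ((2 : ℕ) : ℝ) by norm_num,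
      Real.rpow_natCast]
  rw [volume_ball_eq x₀ hr, ENNReal.ofReal_mul (pow_nonneg hr.le 3), mul_comm,
    ENNReal.mul_rpow_of_nonneg _ _ (by norm_num), ENNReal.ofReal_rpow_of_pos (pow_pos hr 3), h3]

/-- **The Sobolev end of the scaled energy**: for a `C¹` field `w : ℝ³ → ℝ³` with `w ∈ L²`,
`∫_{B(x₀,r)} |w|² ≤ A · δ(w) · r²` with `A = V₁^{2/3} K²` and `δ(w) = ∫ |∇w|²_F` (Hölder on the ball,
`‖w‖₆ ≤ K ‖Dw‖₂`, operator norm `≤` Frobenius norm). [cite: RobinsonRodrigoSadowski2016, Thm 1.8 / Lemma 3.5] -/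
theorem lintegral_ball_sq_le_sobolev {w : EuclideanSpace ℝ (Fin 3) → EuclideanSpace ℝ (Fin 3)}
    (hw : ContDiff ℝ 1 w) (h2 : ∫⁻ x, ‖w x‖ₑ ^ 2 < ⊤) (x₀ : EuclideanSpace ℝ (Fin 3)) {r : ℝ} (hr : 0 < r) :
    ∫⁻ x in ball x₀ r, ‖w x‖ₑ ^ 2 ≤
      sobolevMorreyConst * (∫⁻ x, ENNReal.ofReal (frobeniusNormSq (fderiv ℝ w x))) * ENNReal.ofReal (r ^ 2) := by
  have h2' : eLpNorm w 2 volume < ⊤ := by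
    rw [eLpNorm_lt_top_iff_lintegral_rpow_enorm_lt_top (by norm_num) (by norm_num), ENNReal.toReal_ofNat]
    have e : ∫⁻ x, ‖w x‖ₑ ^ (2 : ℝ) = ∫⁻ x, ‖w x‖ₑ ^ 2 :=
      lintegral_congr fun x => by rw [show (2 : ℝ) = ((2 : ℕ) : ℝ) by norm_num, ENNReal.rpow_natCast]
    rw [e]
    exact h2
  have hS : eLpNorm w 6 volume ≤ (K₆ : ℝ≥0∞) * eLpNorm (fderiv ℝ w) 2 volume :=
    eLpNorm_six_le_eLpNorm_fderiv_two volume finrank_euclideanSpace_fin hw h2'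
  have hD : eLpNorm (fderiv ℝ w) 2 volume ^ 2 ≤ ∫⁻ x, ENNReal.ofReal (frobeniusNormSq (fderiv ℝ w x)) := by
    rw [← lintegral_enorm_sq_eq_eLpNorm_two_pow]
    refine lintegral_mono fun x => ?_
    rw [← ofReal_norm, ← ENNReal.ofReal_pow (norm_nonneg _)]
    exact ENNReal.ofReal_le_ofReal (sq_opNorm_le_frobeniusNormSq _)
  have h6 : eLpNorm w 6 volume ^ 2 ≤ (K₆ : ℝ≥0∞) ^ 2 * ∫⁻ x, ENNReal.ofReal (frobeniusNormSq (fderiv ℝ w x)) :=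
    calc eLpNorm w 6 volume ^ 2 ≤ ((K₆ : ℝ≥0∞) * eLpNorm (fderiv ℝ w) 2 volume) ^ 2 := pow_le_pow_left' hS 2
      _ = (K₆ : ℝ≥0∞) ^ 2 * eLpNorm (fderiv ℝ w) 2 volume ^ 2 := mul_pow _ _ _
      _ ≤ _ := mul_le_mul' le_rfl hD
  calc ∫⁻ x in ball x₀ r, ‖w x‖ₑ ^ 2 ≤ volume (ball x₀ r) ^ (2 / 3 : ℝ) * eLpNorm w 6 volume ^ 2 :=
        lintegral_ball_sq_le_of_eLpNorm_six hw.continuous.aestronglyMeasurable x₀ r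
    _ ≤ (ENNReal.ofReal V₁ ^ (2 / 3 : ℝ) * ENNReal.ofReal (r ^ 2)) *
          ((K₆ : ℝ≥0∞) ^ 2 * ∫⁻ x, ENNReal.ofReal (frobeniusNormSq (fderiv ℝ w x))) := by
        rw [volume_ball_rpow_twoThirds x₀ hr]; exact mul_le_mul' le_rfl h6
    _ = _ := by rw [sobolevMorreyConst]; ring

/-- `min(a, b) ≤ √(a b)` in `ℝ≥0∞`, in the form `min a b ≤ (a * b) ^ (1/2)`. [folklore] -/
theorem min_le_mul_rpow_half (a b : ℝ≥0∞) : min a b ≤ (a * b) ^ (1 / 2 : ℝ) := by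
  have h : min a b ^ (2 : ℕ) ≤ a * b := by
    rw [sq]; exact mul_le_mul' (min_le_left _ _) (min_le_right _ _)
  calc min a b = (min a b ^ (2 : ℕ)) ^ (1 / 2 : ℝ) := by
        rw [← ENNReal.rpow_natCast, ← ENNReal.rpow_mul]; norm_num
    _ ≤ (a * b) ^ (1 / 2 : ℝ) := ENNReal.rpow_le_rpow h (by norm_num)

/-- **The Sobolev–Morrey majorant at one slice**: for a `C¹` field `w` with energy `∫|w|² ≤ e₀`,
`∫_{B(x₀,r)} |w|² ≤ min(e₀, A δ r²) ≤ √(e₀ · A δ) · r` for every centre and EVERY radius `r > 0`. -/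
theorem lintegral_ball_sq_le_sqrt_mul {w : EuclideanSpace ℝ (Fin 3) → EuclideanSpace ℝ (Fin 3)}
    (hw : ContDiff ℝ 1 w) {e₀ : ℝ≥0∞} (he₀ : e₀ ≠ ⊤) (hen : ∫⁻ x, ‖w x‖ₑ ^ 2 ≤ e₀)
    (x₀ : EuclideanSpace ℝ (Fin 3)) {r : ℝ} (hr : 0 < r) :
    ∫⁻ x in ball x₀ r, ‖w x‖ₑ ^ 2 ≤
      (e₀ * (sobolevMorreyConst * ∫⁻ x, ENNReal.ofReal (frobeniusNormSq (fderiv ℝ w x)))) ^ (1 / 2 : ℝ) *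
        ENNReal.ofReal r := by
  set D : ℝ≥0∞ := sobolevMorreyConst * ∫⁻ x, ENNReal.ofReal (frobeniusNormSq (fderiv ℝ w x)) with hD
  have hA : ∫⁻ x in ball x₀ r, ‖w x‖ₑ ^ 2 ≤ e₀ := (setLIntegral_le_lintegral _ _).trans hen
  have hB : ∫⁻ x in ball x₀ r, ‖w x‖ₑ ^ 2 ≤ D * ENNReal.ofReal (r ^ 2) :=
    lintegral_ball_sq_le_sobolev hw (hen.trans_lt he₀.lt_top) x₀ hr
  have hmin := min_le_mul_rpow_half e₀ (D * ENNReal.ofReal (r ^ 2))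
  have hr2 : (ENNReal.ofReal (r ^ 2)) ^ (1 / 2 : ℝ) = ENNReal.ofReal r := by
    rw [ENNReal.ofReal_rpow_of_nonneg (by positivity) (by norm_num), ← Real.sqrt_eq_rpow,
      Real.sqrt_sq hr.le]
  calc ∫⁻ x in ball x₀ r, ‖w x‖ₑ ^ 2 ≤ min e₀ (D * ENNReal.ofReal (r ^ 2)) := le_min hA hB
    _ ≤ (e₀ * (D * ENNReal.ofReal (r ^ 2))) ^ (1 / 2 : ℝ) := hmin
    _ = (e₀ * D) ^ (1 / 2 : ℝ) * ENNReal.ofReal r := by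
        rw [← mul_assoc, ENNReal.mul_rpow_of_nonneg _ _ (by norm_num), hr2]

/-! ## §2  The majorant of a frame solution -/

/-- **`δ(t) < ∞` at every `t ∈ [0,T)` for the frame** (classical on `[0,T)`, Leray–Hopf from a rapidly decaying
datum): on the closed sub-slab `[0, (t+T)/2]` all Sobolev norms are bounded (Tao 2013, Cor. 11.1 + Cor. 4.3 +
Thm. 5.4 (iv), `tao2011_hasBoundedSobolevNormsOn_holds`), and `∫|∇u|²_F ≤ 3 ∫ ‖D¹u‖²`.
[cite: Tao2011, Cor. 11.1] -/
theorem dissipRate_lt_top_of_frame {ν T : ℝ} (hν : 0 < ν)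
    {u : ℝ → EuclideanSpace ℝ (Fin 3) → EuclideanSpace ℝ (Fin 3)} {p : ℝ → EuclideanSpace ℝ (Fin 3) → ℝ}
    (hcl : IsClassicalNSSolutionOn (Ico 0 T) ν 0 u p) (hLH : IsLerayHopfOn T ν 0 (u 0) u)
    (hdec : HasRapidSpatialDecay (u 0)) {t : ℝ} (ht : t ∈ Ico 0 T) : dissipRate u t < ⊤ := by
  set T₁ : ℝ := (t + T) / 2 with hT₁
  have hT₁pos : 0 < T₁ := by rw [hT₁]; linarith [ht.1, ht.2]
  have hT₁T : T₁ < T := by rw [hT₁]; linarith [ht.2]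
  have htT₁ : t ∈ Icc 0 T₁ := ⟨ht.1, by rw [hT₁]; linarith [ht.2]⟩
  have hsol' : IsClassicalNSSolutionOn (Icc 0 T₁) ν 0 u p :=
    hcl.mono (Icc_subset_Ico_right hT₁T) (uniqueDiffOn_Icc hT₁pos)
  have hEn' : ∃ C : ℝ≥0, ∀ s ∈ Icc 0 T₁, ∫⁻ x, ‖u s x‖ₑ ^ 2 ≤ C := by
    refine ⟨(ENNReal.ofReal (2 * VectorCalculus.kineticEnergy (u 0))).toNNReal, fun s hs => ?_⟩
    rw [ENNReal.coe_toNNReal ENNReal.ofReal_ne_top]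
    exact hLH.lintegral_enorm_sq_le hν.le ⟨hs.1, hs.2.trans hT₁T.le⟩
  have hH : HasBoundedSobolevNormsOn (Icc 0 T₁) u :=
    tao2011_hasBoundedSobolevNormsOn_holds hν hT₁pos hsol' hEn' hdec
  obtain ⟨C, hC⟩ := hH 1
  calc dissipRate u t ≤ 3 * ∫⁻ x, ‖iteratedFDeriv ℝ 1 (u t) x‖ₑ ^ 2 :=
        lintegral_frobeniusNormSq_le_three_mul_iteratedFDeriv_one (u t)
    _ ≤ 3 * (C : ℝ≥0∞) := mul_le_mul' le_rfl (hC t htT₁)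
    _ < ⊤ := ENNReal.mul_lt_top (by simp) ENNReal.coe_lt_top

/-- **The Sobolev–Morrey majorant** `Φ_S(t) = √(A · 2E(u₀) · δ(t))` of a velocity field (as an `ℝ≥0`-valued
function of time; the value is the junk `0` at times where `δ(t) = ∞`, which do not occur below `T` for the frame). -/
def sobolevMajorant (u : ℝ → EuclideanSpace ℝ (Fin 3) → EuclideanSpace ℝ (Fin 3)) (t : ℝ) : ℝ≥0 :=
  ((ENNReal.ofReal (2 * VectorCalculus.kineticEnergy (u 0)) * (sobolevMorreyConst * dissipRate u t)) ^
    (1 / 2 : ℝ)).toNNReal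

/-- At a time with `δ(t) < ∞` the coercion of `Φ_S(t)` is the `ℝ≥0∞` square root. -/
theorem coe_sobolevMajorant {u : ℝ → EuclideanSpace ℝ (Fin 3) → EuclideanSpace ℝ (Fin 3)} {t : ℝ}
    (hδ : dissipRate u t < ⊤) :
    (sobolevMajorant u t : ℝ≥0∞) =
      (ENNReal.ofReal (2 * VectorCalculus.kineticEnergy (u 0)) * (sobolevMorreyConst * dissipRate u t)) ^
        (1 / 2 : ℝ) := by
  rw [sobolevMajorant, ENNReal.coe_toNNReal]
  exact ENNReal.rpow_ne_top_of_nonneg (by norm_num) (ENNReal.mul_ne_top ENNReal.ofReal_ne_top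
    (ENNReal.mul_ne_top sobolevMorreyConst_lt_top.ne hδ.ne))

/-- `Φ_S(t)² = A · 2E(u₀) · δ(t)` (when `δ(t) < ∞`). -/
theorem coe_sobolevMajorant_sq {u : ℝ → EuclideanSpace ℝ (Fin 3) → EuclideanSpace ℝ (Fin 3)} {t : ℝ}
    (hδ : dissipRate u t < ⊤) :
    (sobolevMajorant u t : ℝ≥0∞) ^ 2 =
      ENNReal.ofReal (2 * VectorCalculus.kineticEnergy (u 0)) * (sobolevMorreyConst * dissipRate u t) := by
  rw [coe_sobolevMajorant hδ, ← ENNReal.rpow_natCast, ← ENNReal.rpow_mul]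
  norm_num

/-- **Every frame solution has the Morrey-rate majorant `Φ_S`** (at all radii `0 < r < 1`, indeed at all radii,
and all times in `(0,T)`): `∫_{B(x₀,r)} |u(t)|² ≤ Φ_S(t) · r`.  No blow-up hypothesis. -/
theorem morreyRateNear_sobolevMajorant {ν T : ℝ} (hν : 0 < ν) (hT : 0 < T)
    {u : ℝ → EuclideanSpace ℝ (Fin 3) → EuclideanSpace ℝ (Fin 3)} {p : ℝ → EuclideanSpace ℝ (Fin 3) → ℝ}
    (hcl : IsClassicalNSSolutionOn (Ico 0 T) ν 0 u p) (hLH : IsLerayHopfOn T ν 0 (u 0) u)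
    (hdec : HasRapidSpatialDecay (u 0)) : MorreyRateNear u T (sobolevMajorant u) := by
  refine ⟨1, one_pos, 0, hT, fun t ht x₀ r hr _ => ?_⟩
  have htc : t ∈ Ico 0 T := ⟨ht.1.le, ht.2⟩
  have hδ : dissipRate u t < ⊤ := dissipRate_lt_top_of_frame hν hcl hLH hdec htc
  have hen : ∫⁻ x, ‖u t x‖ₑ ^ 2 ≤ ENNReal.ofReal (2 * VectorCalculus.kineticEnergy (u 0)) :=
    hLH.lintegral_enorm_sq_le hν.le ⟨ht.1.le, ht.2.le⟩
  have h := lintegral_ball_sq_le_sqrt_mul ((hcl.contDiff_velocity htc).of_le (by norm_cast))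
    ENNReal.ofReal_ne_top hen x₀ hr
  rw [ENNReal.ofReal_mul (p := ((sobolevMajorant u t : ℝ≥0) : ℝ)) (NNReal.coe_nonneg _), ENNReal.ofReal_coe_nnreal,
    coe_sobolevMajorant hδ]
  exact h

/-- **`Φ_S ∈ L²(0,T)`**: `∫₀ᵀ Φ_S(t)² dt ≤ A · 2E(u₀) · ∫₀ᵀ δ < ∞` — the majorant sits exactly at the energy
floor `a = 2` of J″'s exponent map `q = 6a/(1+a)` (`q(2) = 4`). -/
theorem lintegral_sobolevMajorant_sq_lt_top {ν T : ℝ} (hν : 0 < ν)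
    {u : ℝ → EuclideanSpace ℝ (Fin 3) → EuclideanSpace ℝ (Fin 3)} {p : ℝ → EuclideanSpace ℝ (Fin 3) → ℝ}
    (hcl : IsClassicalNSSolutionOn (Ico 0 T) ν 0 u p) (hLH : IsLerayHopfOn T ν 0 (u 0) u)
    (hdec : HasRapidSpatialDecay (u 0)) :
    ∫⁻ t in Ioo 0 T, (sobolevMajorant u t : ℝ≥0∞) ^ 2 < ⊤ := by
  set E₀ : ℝ≥0∞ := ENNReal.ofReal (2 * VectorCalculus.kineticEnergy (u 0)) with hE₀
  have hcst : E₀ * sobolevMorreyConst ≠ ⊤ := ENNReal.mul_ne_top ENNReal.ofReal_ne_top sobolevMorreyConst_lt_top.ne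
  have hpt : ∀ t ∈ Ioo 0 T, (sobolevMajorant u t : ℝ≥0∞) ^ 2 = E₀ * sobolevMorreyConst * dissipRate u t := by
    intro t ht
    rw [coe_sobolevMajorant_sq (dissipRate_lt_top_of_frame hν hcl hLH hdec ⟨ht.1.le, ht.2⟩), mul_assoc]
  calc ∫⁻ t in Ioo 0 T, (sobolevMajorant u t : ℝ≥0∞) ^ 2
      = ∫⁻ t in Ioo 0 T, E₀ * sobolevMorreyConst * dissipRate u t := setLIntegral_congr_fun measurableSet_Ioo hpt
    _ = E₀ * sobolevMorreyConst * ∫⁻ t in Ioo 0 T, dissipRate u t := lintegral_const_mul' _ _ hcst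
    _ < ⊤ := ENNReal.mul_lt_top hcst.lt_top (dissip_lt_top hcl hLH)

/-! ## §3  The node arrow `AllBlowupsDissipationFiveFourths ⇒ AllBlowupsCoupledClockB` -/

/-- The coupled clock of the Sobolev majorant is a pure power of the dissipation:
`(Φ_S δ)^s = (A · 2E(u₀))^{s/2} · δ^{3s/2}` (`δ(t) < ∞`, `0 ≤ s`). -/
theorem sobolevMajorant_mul_dissipRate_rpow {u : ℝ → EuclideanSpace ℝ (Fin 3) → EuclideanSpace ℝ (Fin 3)} {t : ℝ}
    (hδ : dissipRate u t < ⊤) {s : ℝ} (hs : 0 ≤ s) :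
    ((sobolevMajorant u t : ℝ≥0∞) * dissipRate u t) ^ s =
      (ENNReal.ofReal (2 * VectorCalculus.kineticEnergy (u 0)) * sobolevMorreyConst) ^ (s / 2) *
        (dissipRate u t) ^ (3 * s / 2) := by
  rw [coe_sobolevMajorant hδ, ← mul_assoc (ENNReal.ofReal _), ENNReal.mul_rpow_of_nonneg _ _ (by norm_num : (0:ℝ) ≤ 1/2),
    mul_assoc, ENNReal.mul_rpow_of_nonneg _ _ hs, ← ENNReal.rpow_mul]
  congr 1
  · congr 1; ring
  · have h32 : (dissipRate u t) ^ (1 / 2 : ℝ) * dissipRate u t = (dissipRate u t) ^ (3 / 2 : ℝ) := by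
      conv_lhs => rw [← ENNReal.rpow_one (dissipRate u t), ← ENNReal.rpow_mul, ← ENNReal.rpow_add_of_nonneg _ _
        (by norm_num) (by norm_num)]
      norm_num
    rw [h32, ← ENNReal.rpow_mul]
    congr 1; ring

/-- **`AllBlowupsDissipationFiveFourths ⇒ AllBlowupsCoupledClockB`** (the ROUND-10 memo arrow, now kernel): take
`Φ = Φ_S`; for `0 ≤ s < 5/6` the exponent `b = 3s/2` is `< 5/4`, so `∫ (Φ_S δ)^s = (A·2E)^{s/2} ∫ δ^{3s/2} < ∞`
on the window the dissipation node provides. -/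
theorem allBlowupsCoupledClockB_of_dissipationFiveFourths (hA : AllBlowupsDissipationFiveFourths) :
    AllBlowupsCoupledClockB := by
  intro ν T hν hT u p hcl hLH hdec hext
  refine ⟨sobolevMajorant u, morreyRateNear_sobolevMajorant hν hT hcl hLH hdec, fun s hs0 hs => ?_⟩
  obtain ⟨T₁, hT₁, hint⟩ := hA ν T hν hT u p hcl hLH hdec hext (3 * s / 2) (by positivity) (by linarith)
  set c : ℝ≥0∞ := (ENNReal.ofReal (2 * VectorCalculus.kineticEnergy (u 0)) * sobolevMorreyConst) ^ (s / 2) with hc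
  have hctop : c ≠ ⊤ := ENNReal.rpow_ne_top_of_nonneg (by positivity)
    (ENNReal.mul_ne_top ENNReal.ofReal_ne_top sobolevMorreyConst_lt_top.ne)
  refine ⟨max T₁ 0, max_lt hT₁ hT, ?_⟩
  have hpt : ∀ t ∈ Ioo (max T₁ 0) T, ((sobolevMajorant u t : ℝ≥0∞) * dissipRate u t) ^ s =
      c * (dissipRate u t) ^ (3 * s / 2) := fun t ht =>
    sobolevMajorant_mul_dissipRate_rpow
      (dissipRate_lt_top_of_frame hν hcl hLH hdec ⟨(le_max_right _ _).trans ht.1.le, ht.2⟩) hs0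
  calc ∫⁻ t in Ioo (max T₁ 0) T, ((sobolevMajorant u t : ℝ≥0∞) * dissipRate u t) ^ s
      = ∫⁻ t in Ioo (max T₁ 0) T, c * (dissipRate u t) ^ (3 * s / 2) := setLIntegral_congr_fun measurableSet_Ioo hpt
    _ = c * ∫⁻ t in Ioo (max T₁ 0) T, (dissipRate u t) ^ (3 * s / 2) := lintegral_const_mul' _ _ hctop
    _ ≤ c * ∫⁻ t in Ioo T₁ T, (dissipRate u t) ^ (3 * s / 2) :=
        mul_le_mul' le_rfl (lintegral_mono_set (Ioo_subset_Ioo_left (le_max_left _ _)))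
    _ < ⊤ := ENNReal.mul_lt_top hctop.lt_top hint

/-- **The coupled clock is the weakest typed node of the route**: it is implied by BOTH one-axis nodes,
`AllBlowupsFullMorreyB` (Morrey axis, p444296) and `AllBlowupsDissipationFiveFourths` (dissipation axis, this file),
and implies the crux by name (`l3CascadeJaw_of_allBlowupsCoupledClockB`). -/
theorem allBlowupsCoupledClockB_of_fullMorreyB_or_dissipationFiveFourths
    (h : AllBlowupsFullMorreyB ∨ AllBlowupsDissipationFiveFourths) : AllBlowupsCoupledClockB :=
  h.elim allBlowupsCoupledClockB_of_fullMorreyB allBlowupsCoupledClockB_of_dissipationFiveFourths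

/-- The parent crux BY NAME from either one-axis node, through the coupled clock. -/
theorem l3CascadeJaw_of_fullMorreyB_or_dissipationFiveFourths
    (h : AllBlowupsFullMorreyB ∨ AllBlowupsDissipationFiveFourths) : L3CascadeJaw :=
  l3CascadeJaw_of_allBlowupsCoupledClockB (allBlowupsCoupledClockB_of_fullMorreyB_or_dissipationFiveFourths h)

end Summit.NavierStokesRegularity.NavierStokesRegularity.Theorems.L3TimeExponentPincerSobolevMajorant

end
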